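import Mathlib.Data.Nat.Log
import Mathlib.Algebra.Polynomial.Eval.Defs
import Mathlib.Algebra.Order.BigOperators.Group.Finset
import Literature.Computability.Complexity.ACRealizeOver
import Literature.Computability.Complexity.NCRealize
import Literature.Computability.Complexity.ThresholdGadgets
import HarnessLib

/-!
# `TC⁰ ⊆ NC¹` reduced to one bounded fan-in gadget: weighted thresholds in logarithmic depth

This file carries out the gate-by-gate half of the proof of the named fact
`TC0_subset_NC1 : TC0 ⊆ NC1` (`ConstantDepth.lean`) in the tree's circuit model, and isolates the
single arithmetic ingredient it needs as an explicit hypothesis (a *threshold gadget*):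

  `HG gd gs : ∀ N M, M ≤ N → ∀ (w : Fin M → ℕ) (θ : ℕ),`
  `  NCVec (fun (y : Fin M → Bool) (_ : Unit) => decide (θ ≤ ∑ j, w j * (y j).toNat)) (gd N) (gs N)`

— every weighted threshold function of `M ≤ N` Boolean variables, with ARBITRARY natural weights,
has a `B₂`-circuit of depth `gd N` and size `gs N`. The main result `TC0_subset_NC1_of_gadget`
proves `TC0 ⊆ NC1` from `HG gd gs` together with `gd N ≤ a · log₂ (N + 2) + a` and a polynomial
bound on `gs`. (The gadget itself — iterated addition in depth `O(log N)`, Vollmer 1999 Thm. 1.20,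
a logarithmic-depth comparison, ibid. Thm. 1.24, and the reduction of the weights to `N^{O(N)}`,
Muroga 1971 / Håstad 1994 — is the subject of sibling files; this file does not depend on them.)

## Why arbitrary weights (faithfulness note)

In the tree's model (`Circuit.lean`) a gate is a truth table of some arity `k` together with `k`
argument wires, which may REPEAT, and `Circuit.size` counts gates, not wires. Hence a `TC⁰`
circuit of size `s` on `n` inputs may contain a gate `MAJ_k` with `k` arbitrarily large reading
only `≤ n + s` distinct wires: as a function of those wires it is the weighted threshold
`[k ≤ 2 · ∑ᵤ mult(u) · u]` with arbitrary multiplicities. The textbook argument (Vollmer 1999,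
§1.3, Thm. 1.20 and Thm. 1.24: majority of `m` wires in depth `O(log m)`) bounds the depth by
`O(log (n + s) + log log k)`, which is not `O(log n)` for unbounded `k`; the weight reduction is
what makes the statement true as stated. (`ACC0SubsetTC0.lean` meets the same phenomenon and
removes repeated wires of `∧/∨/MOD` gates by `AccFanIn.lean`; for majority gates multiplicities
are genuine weights and cannot be normalised away.)

## Contents (everything proved; no named facts)

* `GateList.getD_wdepths_mono`, `NCVec.toACRealOver` — weight-monotonicity of depths; a
  unit-depth `B₂` realization (`NCVec`, `NCRealize.lean`) is an `acWeight`-depth realization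
  (`ACRealOver B2`, `ACRealizeOver.lean`).
* `mem_tcBasis_iff`, `numOnes_comp_eq_wsum`, `exists_threshold_of_mem_tcBasis` — every gate of
  `tcBasis` other than `¬` computes, as a function of its DISTINCT sources, a weighted threshold of
  them: `∧ₖ = [k ≤ Σ]`, `∨ₖ = [1 ≤ Σ]`, `MAJₖ = [k ≤ 2Σ]` with `Σ = ∑ᵤ mult(u)·u`.
* `acRealOver_tcGate_of_gadget` — under `HG`, a gate `f ∈ tcBasis` wired to sources in a finite
  type `σ` with `#σ ≤ N` is realized over `B2` at `acWeight`-depth `acWeight f · gd N` (`¬` free)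
  with `gs N + 1` gates.
* `GateList.exists_b2Sim_of_gadget` — gate-by-gate simulation with depth bookkeeping (the pattern
  of `GateList.exists_tcSim`, `ACC0SubsetTC0.lean`; Vollmer 1999, Lemma 1.36(3) / §4.4): a program
  over `tcBasis` on `Fin n` with `L` gates, `n + L ≤ N`, is simulated by a `B2` program at most
  `gs N + 1` times longer, gate `j` being carried at `acWeight`-depth `≤ gd N ·` (its depth).
  The gadget of gate `j` is taken over the finite type of wires gate `j` actually reads, so that
  the relocation depth bound only involves those wires.
* `Circuit.acRealOver_B2_of_tcBasis_of_gadget`, `natPoly_log_bound`, `TC0_subset_NC1_of_gadget`.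

## References

* H. Vollmer, *Introduction to Circuit Complexity* (1999), §1.2 (composition, depth), §1.3
  Thm. 1.20, Thm. 1.24, §1.4 Lemma 1.36, §4.5.2 Cor. 4.35 (`TC⁰ ⊆ NC¹`) [Vollmer1999].
* S. Muroga, *Threshold Logic and its Applications* (1971), Thm. 9.3.2.1; J. Håstad, *On the size
  of weights for threshold gates*, SIAM J. Discrete Math. 7 (1994), §1 (every threshold function
  of `n` variables has integer weights `≤ (n+1)^{(n+1)/2}/2ⁿ`) [Muroga1971] [Hastad1994].
* S. Arora, B. Barak, *Computational Complexity: A Modern Approach* (2009), Def. 6.23, §14.4.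
-/

namespace Literature.Computability.Complexity

open Finset GateList

/-! ### Unit depth dominates `acWeight` depth -/

namespace GateList

variable {ι : Type*}

/-- Gate depths are monotone in the gate weights (Vollmer 1999, §1.2). [cite: Vollmer1999, §1.2] -/
theorem getD_wdepths_mono {w w' : GateFn → ℕ} (hw : ∀ g, w g ≤ w' g) (gs : List (Gate ι)) (m : ℕ) :
    (wdepths w gs).getD m 0 ≤ (wdepths w' gs).getD m 0 := by
  induction gs using List.reverseRecOn generalizing m with
  | nil => simp
  | append_singleton gs g ih =>
    rw [wdepths_append_singleton, wdepths_append_singleton]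
    simp only [List.getD_eq_getElem?_getD]
    rcases Nat.lt_trichotomy m gs.length with hm | rfl | hm
    · rw [List.getElem?_append_left (by simpa using hm),
        List.getElem?_append_left (by simpa using hm)]
      simpa [List.getD_eq_getElem?_getD] using ih m
    · rw [List.getElem?_append_right (by simp), List.getElem?_append_right (by simp)]
      simp only [length_wdepths, Nat.sub_self, List.getElem?_cons_zero, Option.getD_some]
      refine Nat.add_le_add (hw _) (Finset.sup_mono_fun fun a _ => ?_)
      cases g.args a with
      | inl i => exact le_rfl
      | inr m' => simpa [List.getD_eq_getElem?_getD] using ih m'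
    · rw [List.getElem?_eq_none (by simp; omega), List.getElem?_eq_none (by simp; omega)]

/-- Wire depths are monotone in the gate weights (Vollmer 1999, §1.2). [cite: Vollmer1999, §1.2] -/
theorem wireDepthOf_wdepths_mono {w w' : GateFn → ℕ} (hw : ∀ g, w g ≤ w' g) (gs : List (Gate ι))
    (u : ι ⊕ ℕ) : wireDepthOf (wdepths w gs) u ≤ wireDepthOf (wdepths w' gs) u := by
  cases u with
  | inl i => exact le_rfl
  | inr m => exact getD_wdepths_mono hw gs m

end GateList

/-- **A unit-depth `B₂` realization is an `acWeight`-depth realization**: `NCVec f d s` (all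
gates weigh `1`) gives `ACRealOver B2 (f · ()) d s` (negations weigh `0`), since
`acWeight ≤ 1` (Vollmer 1999, §1.2). [cite: Vollmer1999, §1.2] -/
theorem NCVec.toACRealOver {ι : Type*} {f : (ι → Bool) → Unit → Bool} {d s : ℕ}
    (h : NCVec f d s) : ACRealOver B2 (fun x => f x ()) d s := by
  obtain ⟨gs, out, hwf, hB, ho, hl, hdep, hev⟩ := h
  exact ⟨gs, out (), hwf, hB, ho (), hl,
    (wireDepthOf_wdepths_mono (fun g => acWeight_le_one g) gs (out ())).trans (hdep ()),
    fun x => hev x ()⟩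

/-! ### The gates of `tcBasis` as thresholds of their distinct sources -/

/-- Membership in `tcBasis`, unfolded. [folklore] -/
theorem mem_tcBasis_iff (f : GateFn) :
    f ∈ tcBasis ↔ f = GateFn.not ∨ ∃ k, f = GateFn.and k ∨ f = GateFn.or k ∨ f = GateFn.maj k := by
  simp only [tcBasis, Set.mem_union, mem_acBasis_iff, Set.mem_iUnion, Set.mem_singleton_iff]
  constructor
  · rintro ((h | ⟨k, h | h⟩) | ⟨k, h⟩)
    · exact Or.inl h
    · exact Or.inr ⟨k, Or.inl h⟩
    · exact Or.inr ⟨k, Or.inr (Or.inl h)⟩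
    · exact Or.inr ⟨k, Or.inr (Or.inr h)⟩
  · rintro (h | ⟨k, h | h | h⟩)
    · exact Or.inl (Or.inl h)
    · exact Or.inl (Or.inr ⟨k, Or.inl h⟩)
    · exact Or.inl (Or.inr ⟨k, Or.inr h⟩)
    · exact Or.inr ⟨k, h⟩

/-- `MAJₖ ≠ ¬` as gate functions (for `k = 1` they differ on the input `0`). [folklore] -/
theorem GateFn.maj_ne_not (k : ℕ) : GateFn.maj k ≠ GateFn.not := by
  intro h
  have hk : k = 1 := congrArg Sigma.fst h
  subst hk
  have h2 := congrFun (eq_of_heq (Sigma.mk.inj h).2) (fun _ => false)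
  simp [GateFn.numOnes] at h2

/-- `acWeight MAJₖ = 1`. [folklore] -/
@[simp] theorem acWeight_maj (k : ℕ) : acWeight (GateFn.maj k) = 1 := by
  simp [acWeight, GateFn.maj_ne_not]

/-- **The number of true arguments of a gate is a weighted sum over its distinct sources**: if
argument `a` reads source `src a`, then `#{a | y (src a)} = ∑ᵤ #{a | src a = u} · [y u]`
(Vollmer 1999, §1.1: symmetric gates are functions of the multiset of their inputs). [cite: Vollmer1999, §1.1] -/
theorem numOnes_comp_eq_wsum {k : ℕ} {σ : Type*} [Fintype σ] [DecidableEq σ] (src : Fin k → σ)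
    (y : σ → Bool) :
    GateFn.numOnes (fun a => y (src a)) = ∑ u, (univ.filter fun a => src a = u).card * (y u).toNat := by
  unfold GateFn.numOnes
  rw [Finset.card_eq_sum_card_fiberwise (f := src) (t := univ) (fun a _ => mem_univ _)]
  refine Finset.sum_congr rfl fun u _ => ?_
  cases hy : y u
  · simp only [Bool.toNat_false, mul_zero, Finset.card_eq_zero, Finset.filter_eq_empty_iff,
      Finset.mem_filter, mem_univ, true_and]
    intro a ha hau
    rw [hau, hy] at ha
    exact Bool.false_ne_true ha
  · simp only [Bool.toNat_true, mul_one]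
    congr 1
    ext a
    simp only [Finset.mem_filter, mem_univ, true_and, and_iff_right_iff_imp]
    intro hau
    rw [hau, hy]

/-- **Every gate of `tcBasis` other than `¬` is a threshold of its number of ones**:
`∧ₖ(v) = [k ≤ #ones]`, `∨ₖ(v) = [1 ≤ #ones]`, `MAJₖ(v) = [k ≤ 2 · #ones]`
(Vollmer 1999, §1.1 and Def. 1.9). [cite: Vollmer1999, §1.1 and Def. 1.9] -/
theorem exists_threshold_of_mem_tcBasis {f : GateFn} (hf : f ∈ tcBasis) (hne : f ≠ GateFn.not) :
    ∃ θ c : ℕ, c ≤ 2 ∧ ∀ v : Fin f.1 → Bool, f.2 v = decide (θ ≤ c * GateFn.numOnes v) := by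
  rcases (mem_tcBasis_iff f).1 hf with h | ⟨k, h | h | h⟩
  · exact absurd h hne
  · subst h
    refine ⟨k, 1, by norm_num, fun v => ?_⟩
    change decide (∀ i, v i = true) = decide (k ≤ 1 * GateFn.numOnes v)
    rw [one_mul]
    unfold GateFn.numOnes
    by_cases hall : ∀ i, v i = true
    · rw [decide_eq_true hall, eq_comm, decide_eq_true_iff]
      have : (univ.filter fun i => v i = true) = univ := Finset.filter_true_of_mem fun i _ => hall i
      rw [this, card_univ, Fintype.card_fin]
      exact le_rfl
    · rw [decide_eq_false hall, eq_comm, decide_eq_false_iff_not, not_le]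
      push Not at hall
      obtain ⟨i, hi⟩ := hall
      calc (univ.filter fun i => v i = true).card < (univ : Finset (Fin k)).card :=
            Finset.card_lt_card ⟨Finset.filter_subset _ _, fun hsub => by
              have := Finset.mem_filter.1 (hsub (mem_univ i))
              exact hi this.2⟩
        _ = k := by rw [card_univ, Fintype.card_fin]
  · subst h
    refine ⟨1, 1, by norm_num, fun v => ?_⟩
    change decide (∃ i, v i = true) = decide (1 ≤ 1 * GateFn.numOnes v)
    rw [one_mul]
    unfold GateFn.numOnes
    by_cases hex : ∃ i, v i = true
    · rw [decide_eq_true hex, eq_comm, decide_eq_true_iff, Nat.one_le_iff_ne_zero, Ne,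
        Finset.card_eq_zero, Finset.filter_eq_empty_iff]
      push Not
      obtain ⟨i, hi⟩ := hex
      exact ⟨i, mem_univ i, hi⟩
    · rw [decide_eq_false hex, eq_comm, decide_eq_false_iff_not, not_le, Nat.lt_one_iff,
        Finset.card_eq_zero, Finset.filter_eq_empty_iff]
      intro i _ hi
      exact hex ⟨i, hi⟩
  · subst h
    exact ⟨k, 2, le_rfl, fun v => rfl⟩

/-! ### The threshold gadget hypothesis and the gadget of one gate -/

section Gadget

variable (gd gs : ℕ → ℕ)

/-- **A gate of `tcBasis` over `B₂`, given a threshold gadget.** Suppose every weighted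
threshold `[θ ≤ ∑ⱼ wⱼ yⱼ]` of `M ≤ N` variables is realized over `B2` at unit depth `gd N` with
`gs N` gates (`HG`). Then a gate `f ∈ tcBasis` whose arguments read sources `src a` in a finite
type `σ` with `#σ ≤ N` is realized, as a function of the sources, over `B2` at `acWeight`-depth
`acWeight f · gd N` (a `¬` gate is itself, depth `0`) with at most `gs N + 1` gates: by
`exists_threshold_of_mem_tcBasis` and `numOnes_comp_eq_wsum` it is the threshold
`[θ ≤ ∑ᵤ (c · mult u) · yᵤ]` of its distinct sources (Vollmer 1999, §1.4.1, weights by repeated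
inputs; §4.5.2). [cite: Vollmer1999, §1.4.1 and §4.5.2] -/
theorem acRealOver_tcGate_of_gadget
    (HG : ∀ N M : ℕ, M ≤ N → ∀ (w : Fin M → ℕ) (θ : ℕ),
      NCVec (fun (y : Fin M → Bool) (_ : Unit) => decide (θ ≤ ∑ j, w j * (y j).toNat)) (gd N) (gs N))
    {f : GateFn} (hf : f ∈ tcBasis) {σ : Type} [Fintype σ] [DecidableEq σ] {N : ℕ}
    (hσ : Fintype.card σ ≤ N) (src : Fin f.1 → σ) :
    ACRealOver B2 (fun y : σ → Bool => f.2 fun a => y (src a)) (acWeight f * gd N) (gs N + 1) := by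
  by_cases hne : f = GateFn.not
  · subst hne
    exact ((acRealOver_notInput not_mem_B2 (src (0 : Fin 1))).congr fun y => rfl).mono (by simp)
      (by omega)
  · obtain ⟨θ, c, -, hthr⟩ := exists_threshold_of_mem_tcBasis hf hne
    have hw1 : acWeight f = 1 := by simp [acWeight, hne]
    -- the weights of the distinct sources
    set mult : σ → ℕ := fun u => (univ.filter fun a => src a = u).card with hmult
    set e := Fintype.equivFin σ with he
    have hG := HG N (Fintype.card σ) hσ (fun j => c * mult (e.symm j)) θ
    have hG' := (ncVec_proj (ι := σ) fun j : Fin (Fintype.card σ) => e.symm j).comp hG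
    refine ((hG'.toACRealOver).congr fun y => ?_).mono (by rw [hw1, one_mul, zero_add]) (by omega)
    dsimp only
    rw [hthr, numOnes_comp_eq_wsum src y, Finset.mul_sum]
    congr 1
    apply propext
    rw [← e.symm.sum_comp (fun u => c * (mult u * (y u).toNat))]
    simp only [mul_assoc]

end Gadget

/-! ### Gate-by-gate simulation with depth bookkeeping -/

namespace GateList

/-- **Simulation of a `tcBasis` program by a `B₂` program, gate by gate, with depths, given a
threshold gadget.** For a well-formed program `gs` over `tcBasis` on the inputs `Fin n` with
`n + |gs| ≤ N` there are a well-formed program `ns` over `B2` with `|ns| ≤ |gs| · (gs N + 1)` and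
wires `φ j` (`j < |gs|`) of `ns` such that `φ j` carries the value of gate `j` of `gs` on every
input, at `acWeight`-depth at most `gd N ·` (the `acWeight`-depth of gate `j` in `gs`): gate `j`
is replaced by its gadget over the (at most `n + j`) wires it reads
(`acRealOver_tcGate_of_gadget`), relocated behind the simulation of the gates `< j` and re-wired
to the wires carrying those (Vollmer 1999, §1.4, Lemma 1.36 (3) and §4.5.2: replacing oracle
gates by circuits multiplies depth and size by those of the gadgets; the pattern of
`GateList.exists_tcSim`). [cite: Vollmer1999, §1.4 Lemma 1.36 and §4.5.2] -/
theorem exists_b2Sim_of_gadget (gd gs : ℕ → ℕ)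
    (HG : ∀ N M : ℕ, M ≤ N → ∀ (w : Fin M → ℕ) (θ : ℕ),
      NCVec (fun (y : Fin M → Bool) (_ : Unit) => decide (θ ≤ ∑ j, w j * (y j).toNat)) (gd N) (gs N))
    {n N : ℕ} (gl : List (Gate (Fin n))) (hwf : WF gl) (hB : ∀ g ∈ gl, g.fn ∈ tcBasis)
    (hN : n + gl.length ≤ N) :
    ∃ (ns : List (Gate (Fin n))) (φ : ℕ → Fin n ⊕ ℕ), WF ns ∧ (∀ g ∈ ns, g.fn ∈ B2) ∧
      ns.length ≤ gl.length * (gs N + 1) ∧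
      ∀ j < gl.length, OutOK ns.length (φ j) ∧
        (∀ x, wireOf x (vals ns x) (φ j) = (vals gl x).getD j false) ∧
        wireDepthOf (wdepths acWeight ns) (φ j) ≤ gd N * (wdepths acWeight gl).getD j 0 := by
  induction gl using List.reverseRecOn with
  | nil =>
    exact ⟨[], fun _ => Sum.inr 0, WF.nil, by simp, by simp, fun j hj => absurd hj (by simp)⟩
  | append_singleton gl g ih =>
    rw [List.length_append, List.length_singleton] at hN
    obtain ⟨ns, φ, hwfn, hBn, hlen, hφ⟩ := ih hwf.of_append_left
      (fun g' hg' => hB g' (List.mem_append_left _ hg')) (by omega)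
    have hgB : g.fn ∈ tcBasis := hB g (by simp)
    have hok : GateOK gl.length g := hwf.getLast
    -- the distinct sources of `g`, a finite type of cardinality `≤ n + |gl| ≤ N`
    set S : Finset (Fin n ⊕ ℕ) := univ.image g.args with hS
    have hScard : S.card ≤ N := by
      have hsub : S ⊆ (univ : Finset (Fin n)).image Sum.inl ∪ (range gl.length).image Sum.inr := by
        intro u hu
        obtain ⟨a, -, rfl⟩ := mem_image.1 hu
        cases hga : g.args a with
        | inl i => exact mem_union_left _ (mem_image_of_mem _ (mem_univ i))
        | inr m => exact mem_union_right _ (mem_image_of_mem _ (mem_range.2 (hok a m hga)))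
      calc S.card ≤ ((univ : Finset (Fin n)).image Sum.inl ∪ (range gl.length).image Sum.inr).card :=
            card_le_card hsub
        _ ≤ ((univ : Finset (Fin n)).image Sum.inl).card + ((range gl.length).image Sum.inr).card :=
            card_union_le _ _
        _ ≤ (univ : Finset (Fin n)).card + (range gl.length).card :=
            Nat.add_le_add card_image_le card_image_le
        _ ≤ N := by rw [card_univ, Fintype.card_fin, card_range]; omega
    have hσ : Fintype.card ↥S ≤ N := by rw [Fintype.card_coe]; exact hScard
    let src : Fin g.arity → ↥S := fun a => ⟨g.args a, mem_image_of_mem _ (mem_univ a)⟩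
    -- the wires of `ns` carrying the sources of `g`
    let ρ : ↥S → Fin n ⊕ ℕ := fun u => Sum.elim Sum.inl φ u.1
    have hmemS : ∀ u : ↥S, ∃ a, g.args a = u.1 := fun u => by
      obtain ⟨a, -, ha⟩ := mem_image.1 u.2
      exact ⟨a, ha⟩
    have hρOK : WiresOK ns.length ρ := by
      intro u m' hm'
      obtain ⟨a, ha⟩ := hmemS u
      cases hga : u.1 with
      | inl i => simp [ρ, hga] at hm'
      | inr j =>
        simp only [ρ, hga, Sum.elim_inr] at hm'
        rw [hga] at ha
        exact (hφ j (hok a j ha)).1 m' hm'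
    have hρval : ∀ (x : Fin n → Bool) (u : ↥S),
        wireOf x (vals ns x) (ρ u) = wireOf x (vals gl x) u.1 := by
      intro x u
      obtain ⟨a, ha⟩ := hmemS u
      cases hga : u.1 with
      | inl i => simp [ρ, hga]
      | inr j =>
        simp only [ρ, hga, Sum.elim_inr, wireOf_inr]
        rw [hga] at ha
        exact (hφ j (hok a j ha)).2.1 x
    set Dg := univ.sup fun a => wireDepthOf (wdepths acWeight gl) (g.args a) with hDg
    have hρdep : ∀ u, wireDepthOf (wdepths acWeight ns) (ρ u) ≤ gd N * Dg := by
      intro u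
      obtain ⟨a, ha⟩ := hmemS u
      have hle : wireDepthOf (wdepths acWeight gl) (g.args a) ≤ Dg :=
        Finset.le_sup (f := fun a => wireDepthOf (wdepths acWeight gl) (g.args a)) (mem_univ a)
      cases hga : u.1 with
      | inl i => simp [ρ, hga]
      | inr j =>
        simp only [ρ, hga, Sum.elim_inr]
        rw [hga] at ha
        rw [ha, wireDepthOf_inr] at hle
        exact (hφ j (hok a j ha)).2.2.trans (Nat.mul_le_mul_left _ hle)
    -- the gadget of `g` over its sources, relocated behind `ns` along `ρ`
    have hgad : ACRealOver B2 (fun y : ↥S → Bool => g.op fun a => y (src a)) (acWeight g.fn * gd N)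
        (gs N + 1) := acRealOver_tcGate_of_gadget gd gs HG hgB hσ src
    obtain ⟨gs', o, hwf', hB', ho', hl', hdep', hev'⟩ := hgad
    obtain ⟨ds', hds', hlen', hle'⟩ :=
      wdepths_append_reloc_le acWeight ns gs' ρ hρOK (gd N * Dg) hρdep
    refine ⟨ns ++ gs'.map (reloc ρ ns.length),
      fun j => if j = gl.length then shiftWire ρ ns.length o else φ j,
      hwfn.append_reloc hwf' hρOK, ?_, ?_, ?_⟩
    · -- basis
      intro g' hg'
      rw [List.mem_append, List.mem_map] at hg'
      rcases hg' with hg' | ⟨g₀, hg₀, rfl⟩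
      · exact hBn g' hg'
      · rw [reloc_fn]; exact hB' g₀ hg₀
    · -- length
      rw [List.length_append, List.length_map, List.length_append, List.length_singleton,
        add_one_mul]
      exact Nat.add_le_add hlen hl'
    · -- the wires
      intro j hj
      dsimp only
      rw [List.length_append, List.length_singleton] at hj
      rcases (Nat.lt_succ_iff_lt_or_eq.1 hj) with hj | rfl
      · -- an old gate
        obtain ⟨hoj, hvj, hdj⟩ := hφ j hj
        rw [if_neg (Nat.ne_of_lt hj)]
        refine ⟨fun m' hm' => (hoj m' hm').trans_le (by simp), fun x => ?_, ?_⟩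
        · rw [wireOf_vals_append _ _ _ _ hoj, hvj x, vals_append_singleton,
            List.getD_eq_getElem?_getD, List.getD_eq_getElem?_getD,
            List.getElem?_append_left (by simpa using hj)]
        · rw [wireDepthOf_wdepths_append _ _ _ _ hoj, wdepths_append_singleton,
            List.getD_eq_getElem?_getD, List.getElem?_append_left (by simpa using hj)]
          rw [List.getD_eq_getElem?_getD] at hdj
          exact hdj
      · -- the new gate
        rw [if_pos rfl]
        refine ⟨?_, fun x => ?_, ?_⟩
        · intro m' hm'
          cases hoo : o with
          | inl u =>
            rw [hoo] at hm'
            simp only [shiftWire] at hm'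
            have := hρOK u m' hm'
            rw [List.length_append]; omega
          | inr m'' =>
            rw [hoo] at hm'
            simp only [shiftWire, Sum.inr.injEq] at hm'
            have := ho' m'' hoo
            rw [List.length_append, List.length_map]; omega
        · rw [vals_append_reloc ns gs' ρ hρOK x,
            wireOf_shiftWire x (vals ns x) _ (length_vals ns x) ρ hρOK o, hev',
            vals_append_singleton, List.getD_eq_getElem?_getD,
            List.getElem?_append_right (by simp), length_vals, Nat.sub_self]
          simp only [List.getElem?_cons_zero, Option.getD_some]
          simp only [hρval x]
          rfl
        · rw [getD_wdepths_append_singleton, hds', mul_add]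
          cases hoo : o with
          | inl u =>
            simp only [shiftWire]
            rw [wireDepthOf_append_of_lt _ _ (ρ u) (fun m' hm' => by
              rw [length_wdepths]; exact hρOK u m' hm')]
            exact (hρdep u).trans (Nat.le_add_left _ _)
          | inr m'' =>
            simp only [shiftWire, wireDepthOf_inr, List.getD_eq_getElem?_getD]
            rw [List.getElem?_append_right (by rw [length_wdepths]; omega), length_wdepths,
              Nat.add_sub_cancel]
            have h1 := hle' m''
            rw [List.getD_eq_getElem?_getD, List.getD_eq_getElem?_getD] at h1
            refine h1.trans (Nat.add_le_add ?_ le_rfl)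
            have h2 := hdep'
            rw [hoo, wireDepthOf_inr, List.getD_eq_getElem?_getD, mul_comm] at h2
            exact h2

end GateList

/-! ### Circuits -/

/-- **Every circuit over `tcBasis` on `n` inputs is computed by a `B₂` circuit of `acDepth` at most
`gd N · acDepth` and size at most `size · (gs N + 1)` whenever `n + size ≤ N`**, given the
threshold gadget `HG gd gs` (gate-by-gate simulation, `GateList.exists_b2Sim_of_gadget`;
Vollmer 1999, §4.5.2, Cor. 4.35 with §1.4 Lemma 1.36). [cite: Vollmer1999, §4.5.2 Cor. 4.35 and §1.4 Lemma 1.36] -/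
theorem Circuit.acRealOver_B2_of_tcBasis_of_gadget (gd gs : ℕ → ℕ)
    (HG : ∀ N M : ℕ, M ≤ N → ∀ (w : Fin M → ℕ) (θ : ℕ),
      NCVec (fun (y : Fin M → Bool) (_ : Unit) => decide (θ ≤ ∑ j, w j * (y j).toNat)) (gd N) (gs N))
    {n N : ℕ} (C : Circuit (Fin n)) (hC : C.IsOver tcBasis) (hN : n + C.size ≤ N) :
    ACRealOver B2 C.eval (gd N * C.acDepth) (C.size * (gs N + 1)) := by
  obtain ⟨ns, φ, hwf, hB, hlen, hφ⟩ :=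
    GateList.exists_b2Sim_of_gadget gd gs HG C.gates (wf_gates C) hC hN
  have hdep₀ : C.acDepth = wireDepthOf (wdepths acWeight C.gates) C.output :=
    circuit_depthWith C acWeight
  cases ho : C.output with
  | inl i =>
    refine ⟨ns, Sum.inl i, hwf, hB, (fun m' h => by cases h), hlen, (by simp), fun x => ?_⟩
    rw [circuit_eval, ho]
    rfl
  | inr j =>
    have hj : j < C.gates.length := C.wf_output j ho
    obtain ⟨hok, hval, hdep⟩ := hφ j hj
    refine ⟨ns, φ j, hwf, hB, hok, hlen, ?_, fun x => ?_⟩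
    · refine hdep.trans (Nat.mul_le_mul_left _ (le_of_eq ?_))
      rw [hdep₀, ho, wireDepthOf_inr]
    · rw [hval x, circuit_eval, ho, wireOf_inr]

/-! ### Growth bookkeeping -/

/-- Evaluation of a polynomial over `ℕ` is monotone in the argument. [folklore] -/
private theorem natPoly_eval_mono' (p : Polynomial ℕ) {x y : ℕ} (h : x ≤ y) : p.eval x ≤ p.eval y := by
  rw [Polynomial.eval_eq_sum_range, Polynomial.eval_eq_sum_range]
  exact Finset.sum_le_sum fun i _ => Nat.mul_le_mul_left _ (Nat.pow_le_pow_left h i)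

/-- For `1 ≤ n`, `p(n) ≤ p(1) · n ^ deg p` over `ℕ`. [folklore] -/
private theorem natPoly_eval_le_eval_one_mul_pow' (p : Polynomial ℕ) {n : ℕ} (hn : 1 ≤ n) :
    p.eval n ≤ p.eval 1 * n ^ p.natDegree := by
  rw [Polynomial.eval_eq_sum_range, Polynomial.eval_eq_sum_range, Finset.sum_mul]
  refine Finset.sum_le_sum fun i hi => ?_
  rw [one_pow, mul_one]
  exact Nat.mul_le_mul_left _
    (Nat.pow_le_pow_right hn (Nat.lt_succ_iff.mp (Finset.mem_range.mp hi)))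

/-- **The logarithm of a polynomially bounded quantity is `O(log n)`**: for every polynomial `p`
over `ℕ` there is `c` with `log₂ (n + p(n) + 2) ≤ c · log₂ n + c` for all `n` (for `n ≥ 1`,
`n + p(n) + 2 ≤ (p(1) + 3) · n ^ (deg p + 1)`). [folklore] -/
theorem natPoly_log_bound (p : Polynomial ℕ) :
    ∃ c : ℕ, ∀ n : ℕ, Nat.log 2 (n + p.eval n + 2) ≤ c * Nat.log 2 n + c := by
  set D := p.natDegree with hD
  set K := p.eval 1 + 3 with hK
  refine ⟨Nat.log 2 K + D + 2, fun n => ?_⟩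
  rcases Nat.eq_zero_or_pos n with rfl | hn
  · have h0 : 0 + p.eval 0 + 2 ≤ K := by
      have := natPoly_eval_mono' p (Nat.zero_le 1)
      omega
    calc Nat.log 2 (0 + p.eval 0 + 2) ≤ Nat.log 2 K := Nat.log_mono_right h0
      _ ≤ _ := by omega
  · have h1 := natPoly_eval_le_eval_one_mul_pow' p hn
    -- `n + p(n) + 2 ≤ K · n ^ (D + 1)`
    have hpow : n ^ D ≤ n ^ (D + 1) := Nat.pow_le_pow_right hn (Nat.le_succ D)
    have hn1 : n ≤ n ^ (D + 1) := by
      calc n = n ^ 1 := (pow_one n).symm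
        _ ≤ n ^ (D + 1) := Nat.pow_le_pow_right hn (by omega)
    have hone : 1 ≤ n ^ (D + 1) := Nat.one_le_pow _ _ hn
    have hle : n + p.eval n + 2 ≤ K * n ^ (D + 1) := by
      have : p.eval n ≤ p.eval 1 * n ^ (D + 1) := h1.trans (Nat.mul_le_mul_left _ hpow)
      calc n + p.eval n + 2 ≤ n ^ (D + 1) + p.eval 1 * n ^ (D + 1) + 2 * n ^ (D + 1) := by omega
        _ = K * n ^ (D + 1) := by rw [hK]; ring
    -- `K · n^(D+1) < 2 ^ (log₂ K + 1 + (D + 1) · (log₂ n + 1))`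
    have hKlt : K < 2 ^ (Nat.log 2 K + 1) := Nat.lt_pow_succ_log_self one_lt_two K
    have hnlt : n < 2 ^ (Nat.log 2 n + 1) := Nat.lt_pow_succ_log_self one_lt_two n
    have hnpow : n ^ (D + 1) < 2 ^ ((Nat.log 2 n + 1) * (D + 1)) := by
      rw [pow_mul]
      exact Nat.pow_lt_pow_left hnlt (by omega)
    have hlt : n + p.eval n + 2 < 2 ^ (Nat.log 2 K + 1 + (Nat.log 2 n + 1) * (D + 1)) := by
      rw [pow_add]
      exact hle.trans_lt (Nat.mul_lt_mul'' hKlt hnpow)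
    have hlog : Nat.log 2 (n + p.eval n + 2) < Nat.log 2 K + 1 + (Nat.log 2 n + 1) * (D + 1) :=
      Nat.log_lt_of_lt_pow (by omega) hlt
    have hexp : Nat.log 2 K + 1 + (Nat.log 2 n + 1) * (D + 1) ≤
        (Nat.log 2 K + D + 2) * Nat.log 2 n + (Nat.log 2 K + D + 2) + 1 := by
      nlinarith [Nat.zero_le (Nat.log 2 K * Nat.log 2 n), Nat.zero_le (Nat.log 2 n)]
    omega

/-! ### `TC⁰ ⊆ NC¹` from the threshold gadget -/

/-- **`TC⁰ ⊆ NC¹`, given a logarithmic-depth polynomial-size threshold gadget over `B₂`.** If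
every weighted threshold of `M ≤ N` Boolean variables (arbitrary natural weights) has a
`B₂`-circuit of depth `gd N ≤ a · log₂ (N + 2) + a` and size `gs N ≤ q(N)` for a polynomial `q`,
then `TC0 ⊆ NC1`: a `TC⁰` family of depth `d` and size `≤ p(n)` over `tcBasis` is simulated gate by
gate (`Circuit.acRealOver_B2_of_tcBasis_of_gadget` with `N = n + p(n)`) by a `B₂` family of
`acDepth ≤ gd N · d ≤ c · log₂ n + c` (`natPoly_log_bound`) and size
`≤ p(n) · (q(n + p(n)) + 1)` (Vollmer 1999, §4.5.2, Cor. 4.35: `TC⁰ ⊆ NC¹`, via Thm. 1.20 and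
Thm. 1.24; the weights are handled by Muroga 1971, Thm. 9.3.2.1 / Håstad 1994, §1).
[cite: Vollmer1999, §4.5.2 Cor. 4.35] -/
theorem TC0_subset_NC1_of_gadget (gd gs : ℕ → ℕ)
    (HG : ∀ N M : ℕ, M ≤ N → ∀ (w : Fin M → ℕ) (θ : ℕ),
      NCVec (fun (y : Fin M → Bool) (_ : Unit) => decide (θ ≤ ∑ j, w j * (y j).toNat)) (gd N) (gs N))
    (hgd : ∃ a : ℕ, ∀ N, gd N ≤ a * Nat.log 2 (N + 2) + a)
    (hgs : ∃ q : Polynomial ℕ, ∀ N, gs N ≤ q.eval N) : TC0 ⊆ NC1 := by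
  obtain ⟨a, ha⟩ := hgd
  obtain ⟨q, hq⟩ := hgs
  rintro L ⟨d, p, C, hC, hdec⟩
  obtain ⟨c, hc⟩ := natPoly_log_bound p
  have main : ∀ n, ∃ D : Circuit (Fin n), D.IsOver B2 ∧
      D.acDepth ≤ (a * d * c) * Nat.log 2 n + (a * d * c + a * d) ∧
      D.size ≤ p.eval n * (q.eval (n + p.eval n) + 1) ∧ ∀ x, D.eval x = (C n).eval x := by
    intro n
    obtain ⟨hB, hd, hs⟩ := hC n
    set N := n + p.eval n with hN
    have hNle : n + (C n).size ≤ N := Nat.add_le_add_left hs n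
    have h := (C n).acRealOver_B2_of_tcBasis_of_gadget gd gs HG hB hNle
    have hdepth : gd N * (C n).acDepth ≤ (a * d * c) * Nat.log 2 n + (a * d * c + a * d) := by
      have h1 : gd N * (C n).acDepth ≤ (a * Nat.log 2 (N + 2) + a) * d :=
        Nat.mul_le_mul (ha N) hd
      have h2 : Nat.log 2 (N + 2) ≤ c * Nat.log 2 n + c := hc n
      have h3 : (a * Nat.log 2 (N + 2) + a) * d ≤ (a * (c * Nat.log 2 n + c) + a) * d :=
        Nat.mul_le_mul_right d (Nat.add_le_add_right (Nat.mul_le_mul_left a h2) a)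
      refine h1.trans (h3.trans (le_of_eq ?_))
      ring
    have hsize : (C n).size * (gs N + 1) ≤ p.eval n * (q.eval (n + p.eval n) + 1) :=
      Nat.mul_le_mul hs (Nat.add_le_add_right (hq N) 1)
    obtain ⟨D, hDB, hDd, hDs, hDe⟩ := (h.mono hdepth hsize).toCircuit
    exact ⟨D, hDB, hDd, hDs, hDe⟩
  choose D hD using main
  refine ⟨a * d * c + a * d, p * (q.comp (Polynomial.X + p) + 1), D,
    fun n => ⟨(hD n).1, ?_, ?_⟩, fun x => ?_⟩
  · have := (hD n).2.1
    dsimp only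
    rw [pow_one]
    nlinarith [Nat.zero_le (a * d * Nat.log 2 n)]
  · have he : (p * (q.comp (Polynomial.X + p) + 1)).eval n = p.eval n * (q.eval (n + p.eval n) + 1) := by
      simp only [Polynomial.eval_mul, Polynomial.eval_add, Polynomial.eval_one,
        Polynomial.eval_comp, Polynomial.eval_X]
    dsimp only
    rw [he]
    exact (hD n).2.2.1
  · rw [(hD x.length).2.2.2]
    exact hdec x

end Literature.Computability.Complexity
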